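import Literature.IUT.HodgeArakelov.ThetaEvaluationSettingModelOfOrbitLift
import Literature.AnabelianGeometry.EtaleTheta.Discharge.Sec2Prop214iiiInversionOfModel
import Literature.AnabelianGeometry.EtaleTheta.SettingModelTateInversionTheta
import Literature.AnabelianGeometry.EtaleTheta.SettingModelTateRigidityOfRecordClosed
import Literature.IUT.HodgeArakelov.EtaleThetaDataOfSettingCor218i
import HarnessLib

/-!
# [IUTchII] Prop 2.2 (ii)′ — the μ_{2l}-clause closer AT THE [EtTh] MODEL OF RECORD `modelTate p = modelχq p 1 2`:
# every (R1) ι-datum binder, every §1 named-fact binder AND the class-level ι-statement (GAP D-G-w4d010-2f, FIXED-LIFT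
# form `h14fix` of p457679) DISCHARGED; residual = (H1) F-2633 at the instance + the [IUTchII]-side data (proof-only; D-0079 K-L6)

S. Mochizuki, *Inter-universal Teichmüller theory II*, kurims manuscript (Dec. 2020) §2, Prop. 2.2 (ii) p. 66 l. 51–61
(«together with the condition of invariance with respect to `ι` [cf. [EtTh], Proposition 1.4, (ii); the proof of [EtTh],
Theorem 1.6, (iii)], determines a specific `μ_{2l}`-orbit `θ^ι(Π_v) ⊆ θ(Π_v)`»; claim key `Mochizuki2012`, DISPUTED,
D-0012) [claim: Mochizuki2012, status: disputed] (IUTchII §2 Prop 2.2 (ii), kurims p.66); S. Mochizuki, *The étale theta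
function and its Frobenioid-theoretic manifestations* [EtTh], Publ. RIMS **45** (2009) (refereed): Prop. 1.4 (ii) PRIMS PDF
p. 22 («`Θ̈(Ü) = −Θ̈(Ü⁻¹)`, `Θ̈(−Ü) = −Θ̈(Ü)`»), Prop. 1.5 (ii), (iii) p. 23, Thm. 1.6 (i)–(iii) p. 24, Def. 2.1 p. 36 /
Prop. 2.2 (i) p. 37 (the inversion `ι`), Def. 2.5 (i) p. 39, Def. 2.7 p. 41 [cite: MochizukiEtTh2009, Thm 1.6 (iii) p.24].

Cell `abc-iut`, seat abc-iut-w5-d072 (gen 4; (R1) ι-datum custody lineage of node IUTchII:Prop2.2(ii): p416287 `inversionAlpha`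
/ `prop22_ii'_model_of_inversion`, p416913 `thetaCompanionOfAut`, p420219 `toZ_inversion_generator_of_inversion`);
D-0079 programme L-K, K-L6 slice (director-abc W6 (d) 13:24:23Z; abc-iut-L6-lead 13:21:50Z: the «r» rows Prop2.2(ii) /
Prop3.1(i) hinge on GAP row D-G-w4d010-2f only), row «PROP22ii-IOTA-DATUM-AT-MODELTATE» (CLAIM 16:19:46Z; abc-iut-w4-d010 g11
17:06:48Z / 17:09:46Z: «the NV instance at modelTate is w5-d072 g4's file»). PROOF-ONLY companion: NO definition, NO
instance, NO new named fact; every input consumed BY NAME (layer L2's stage-2 files of abc-iut-L2-t5 / L2-t6 / L2-t8 /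
L2-d1 / w5-d249 / f-149; abc-iut-w4-d010's `ThetaEvaluationSettingModelOfOrbitLift` p457679; abc-iut-L2-t2's
`transport_eq_autMap`); nothing landed is edited or restated. Data of record as in abc-iut-w5-d233's
`BadPlaceSettingAtModelTate` / abc-iut-w4-d038's `MonoThetaProjectiveBridgeEtThAtModelTate` (Galois factor `inr`, class
`η̈♯ = etaDdχq`, `X̲̲ := Huuχq` via `doubleUnderlineχqOfEtaRes`).

STATE OF RECORD. The L6 closers of the μ_{2l}-clause of IUTchII:Prop2.2(ii) at `D := etaleThetaDataOfSetting'` — closer of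
record `prop22_ii'_model_of_hinv_of_prop15_of_origin_orbit` / companion form
`prop22_ii'_model_of_inversion_of_prop15_of_origin_orbit|_fixed` (abc-iut-w4-d010, p457679, over p430763 / p417690) — are
universally quantified over an [EtTh] §1 theta setting and carry as binders: the (R1) ι-DATUM (`ι`, `hι`, companion `c`,
`hZ`, `δ`/`hιι`, `hβ`, deck element `ε`), the §1 named facts `IsEtThOrigin` (F-2498), `Prop15iii` (F-0591), `Prop15ii`
(F-2503), (H1) `PiYddCharacteristic C` (F-2633), the [IUTchII]-side data (`S`, `eS`, `hl`, `T₀`, `Dec`) and ONE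
class-level statement — `h14orbit` («`ι_*` carries `η̈^Θ|_{Π^tp_Ÿ̲̲}` into its `Π^tp_Y`-orbit») or its fixed-lift form
`h14fix` («`ι_*` fixes `η̈^Θ|_{Π^tp_Ÿ̲̲}`»): GAP-LEDGER D-G-w4d010-2f (an L2 proof row, C-R25 (iv)).

THIS FILE.
§1 (abstract junction, any `D`, `E`, `C`, `ι`, `c`):
* `autMap_comap_eq_comap_transport` — NATURALITY: abc-iut-L6-t1's `ContH1Aut.autMap` at abc-iut-w5-d072's pair
  `(inversionAlpha C ι hι, c.thetaIso)` applied to the pull-back of `x ∈ H¹(Π^tp_Ÿ, Δ_Θ)` IS the pull-back of abc-iut-L2-t1's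
  transport `ι_* x = transport c h16 x` (via abc-iut-L2-t2's `transport_eq_autMap`; `rfl` on representatives);
* `prop22_ii'_model_of_transport_conj_of_prop15_of_origin` — the named-fact-route closer with the class-level input in
  abc-iut-L2-t1's TRANSPORT vocabulary, `∃ τ ∈ Π^tp_X̲̲ ∩ Π^tp_Y, ι_* η̈^Θ = τ·η̈^Θ` (junction with GAP row G-L2t2-1 `hιη`;
  abc-iut-w4-d014's `ContH1.comap_conj`; consumer `…_of_origin_orbit` p457679).
§2 (AT THE MODEL):
* `autMap_comap_etaDd_eq_self_modelχq` — at `modelχq p i j` (every `i`, even `j`), for every `E` with `E.etaDd = etaDdχq`,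
  every `ι`-stable `X̲̲`-choice and EVERY theta companion of the cocycle-corrected inversion `ι := inversionχq`
  (abc-iut-w5-d249 / L2-d1), **abc-iut-w4-d010's binder `h14fix` HOLDS**: the pair `(ι|Π^tp_X̲̲, ι^Θ)` FIXES the pull-back of
  `η̈^Θ` to `Π_Ÿ(Π)` — abc-iut-L2-d1's `transport_etaDdχq` (`ι_* η̈♯ = η̈♯`) through §1's naturality; and the DIAGNOSTIC
  `h14iota_iff_deck_fixes_modelχq`: the original ε-PINNED `h14iota` (p430763) holds at this representative iff the deck
  element fixes the pull-back of `η̈♯` (abc-iut-w4-d010 g11's constraint (a) «the ι-representative is load-bearing», STATUS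
  14:56:24Z, kernel-exact at the model; no side taken on which lift print's `ι` denotes);
* `prop22_ii'_modelχq_of_etaDd_eq` — the μ_{2l}-clause closer at `modelχq p i j` (via `…_of_origin_fixed`) with the WHOLE
  (R1) ι-datum and the guard `IsEtThOrigin` THEOREMS: `ι := inversionχq`; `hι` the only `X̲̲`-dependent clause (kept);
  companion `thetaCompanionOfAut` (abc-iut-w5-d072 p416913; `IsInversionAut.map_deltaTemp`, `hasThetaTopology_modelχq`);
  `hZ` = `IsInversionAut.toZ_apply` (abc-iut-L2-d1 `isInversionAut_inversionχq`); `ι² = id` (`inversionχq_inversionχq`,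
  `δ := 1`); `hβ` from `thetaIso_inversionχq_apply_eq_self`; `ε` from abc-iut-w4-d010's `exists_deck_element`; `γ` from
  abc-iut-L2-t8's `toLZ_surjective`; `h14fix` as above; `hC`/`hS`/`hO` = `compat_modelχq` (abc-iut-f-149) /
  `modelχq_sec2Hyps` (abc-iut-L2-t8) / `modelχq_isEtThOrigin` (abc-iut-L2-t5); residual there: `h15`, `h15ii`, (H1), data;
* `prop22_ii'_modelTate_ofSection` — at the Tate instance `modelTate p = modelχq p 1 2`, section datum `E_s` of ANY continuous
  Galois section `s` carrying `η̈♯`: ALSO [EtTh] Prop. 1.5 (iii) (F-0591; abc-iut-L2-t6's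
  `prop15iii_etaleThetaDataOfClass_etaDdχq`) and Prop. 1.5 (ii) (F-2503; abc-iut-L2-t8's `prop13_prop15_sectionData_modelTate`)
  are THEOREMS;
* **`prop22_ii'_modelTate`** — at `s := inr` and the `X̲̲` OF RECORD the `ι`-stability `hι` is abc-iut-L2-d1's
  `map_Huuχq_inversionχq`, so for every odd `l` the repaired `Prop22_ii' Dec` (abc-iut-L6-t19's `IotaInvariantTheta'`) holds
  for EVERY [IUTchII]-side datum `(S, eS, hl, T₀, Dec)` GIVEN ONLY (H1) `PiYddCharacteristic C` (FACT-LIST F-2633 AT THIS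
  INSTANCE: «every topological automorphism of `Π^tp_X̲̲ = Huuχq` stabilises `Π^tp_Ÿ̲̲`», [EtTh] Cor. 2.18 (i)-class tempered
  anabelian input — NOT proved here).
RESIDUAL OF RECORD for the μ_{2l}-clause of IUTchII:Prop2.2(ii) at the model of record: {(H1) F-2633 at the instance;
[IUTchII]-side DATA} — NO ι-datum binder, NO class-level binder, NO §1 fact binder. The «respectively» (∞θ) clause is
abc-iut-w5-d187's lineage (`inftyClause_of_origins_of_prop15iii`) and is not touched here.

HONEST LABEL. `modelχq` / `modelTate` is a SEMI-SYNTHETIC model of the typed [EtTh] §1 interface (`K = ℚ_p`, `q_X = p²`,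
`Π^tp_X = (F̂₂ ×_Ẑ ℤ) ⋊ G_{ℚ_p}`; not the tempered `π₁` of a curve, no theta FUNCTION): binder-discharge /
joint-satisfiability evidence for the typed interface and the kernel record that, at the stage-2 inhabitant, the ι-datum
and the fixed-lift class-level clause of the L6 closer are not assumptions. The [IUTchII] claim key `Mochizuki2012` is
DISPUTED (D-0012) and nothing of it is asserted; nothing of [EtTh] is asserted; no side is taken on [IUTchIII] Cor. 3.12
nor on which lift of the inversion print's `ι` denotes; typed ≠ proved; instantiated ≠ endorsed; nothing here bears on
whether abc is proved or refuted. bears_on: LADDER-ABC:A2.L-K (K-L6, IUTchII:Prop2.2(ii), GAP D-G-w4d010-2f instance form)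
→ rung 0 `Summit.ABC`.
-/

noncomputable section

open Literature.AnabelianGeometry.EtaleTheta (ContH1 ThetaSetting)
open Literature.AnabelianGeometry.EtaleTheta
open _root_.Topology

namespace Literature.IUT.HodgeArakelov

namespace EtaleThetaDataOfSetting

open CohomologySystemOfContH1

variable {p : ℕ} [Fact p.Prime] {D : Literature.AnabelianGeometry.EtaleTheta.ThetaSetting p}
  {E : D.EtaleThetaData} {l : ℕ} (C : E.DoubleUnderline l)
  (ι : D.PiTemp ≃ₜ* D.PiTemp) (hι : C.Huu.map ι.toMulEquiv.toMonoidHom = C.Huu)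
  (c : ThetaSetting.ThetaCompanion ι)

/-! ## §1. Junction: abc-iut-L2-t1's transport `ι_*` ↔ the L6 closer's `autMap` on the pull-back to `Π_Ÿ(Π)` -/

/-- **Naturality**: the action of the pair `(ι|Π^tp_X̲̲, ι^Θ)` on the pull-back of a class `x ∈ H¹(Π^tp_Ÿ, Δ_Θ)` to
`Π_Ÿ(Π) ⊆ Π^tp_X̲̲` (abc-iut-L6-t1's `ContH1Aut.autMap` at abc-iut-w5-d072's pair) IS the pull-back of abc-iut-L2-t1's
transport `ι_* x` ([EtTh] Thm. 1.6 (iii) «the isomorphism of cohomology groups induced by `ι`»).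
[cite: MochizukiEtTh2009, Thm 1.6 (iii) p.24] -/
theorem autMap_comap_eq_comap_transport (h16 : ThetaSetting.Thm16i ι)
    (hH : ∀ x, x ∈ PiYdd C ↔ inversionAlpha C ι hι x ∈ PiYdd C) (x : D.H1 D.GtpYdd) :
    ContH1Aut.autMap (phi C) D.DeltaTheta (inversionAlpha C ι hι) c.thetaIso (thetaCompanion_phi C ι hι c)
        (thetaCompanion_mem_deltaTheta ι c) (symm_mem_inf_top (PiYdd C) (inversionAlpha C ι hι) hH)
        (ContH1.comap D.toTheta D.DeltaTheta C.Huu.subtype continuous_subtype_val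
          (map_subtype_piYdd_inf_le_GtpYdd C ⊤) x) =
      ContH1.comap D.toTheta D.DeltaTheta C.Huu.subtype continuous_subtype_val
        (map_subtype_piYdd_inf_le_GtpYdd C ⊤) (ThetaSetting.transport c h16 x) := by
  rw [ThetaSetting.transport_eq_autMap ι c h16]
  induction x using QuotientGroup.induction_on with
  | H f => rfl


/-- **IUTchII:Prop2.2(ii)′ at the model from abc-iut-L2-t1's TRANSPORT `ι_* η̈^Θ`** (Thm. 1.6 (iii) vocabulary; junction
with GAP row G-L2t2-1 `hιη`): if `ι` satisfies Thm. 1.6 (i) and carries `η̈^Θ` to a conjugate `τ · η̈^Θ` by an element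
`τ ∈ Π^tp_X̲̲ ∩ Π^tp_Y` — in particular if `ι_* η̈^Θ = η̈^Θ` (`τ = 1`) — then abc-iut-w4-d010's ORBIT binder `h14orbit` holds
(`autMap_comap_eq_comap_transport` + abc-iut-w4-d014's `ContH1.comap_conj`), whence `Prop22_ii' Dec` by
`prop22_ii'_model_of_inversion_of_prop15_of_origin_orbit` (p457679) on the named-fact route.
[claim: Mochizuki2012, status: disputed] (IUTchII §2 Prop 2.2 (ii), kurims p.66) -/
theorem prop22_ii'_model_of_transport_conj_of_prop15_of_origin (hι : C.Huu.map ι.toMulEquiv.toMonoidHom = C.Huu)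
    [(PiYdd C).Normal] [D.GtpYdd.Normal]
    (hC : D.Compat) (hS : D.Sec2Hyps) (hchar : PiYddCharacteristic C) (S : BadPlaceSetting.{0})
    (eS : (Pi C) ≃ₜ* S.PiX) (hl : S.l = l) {T₀ : TemperedCoverings S (Pi C)}
    (Dec : SubgraphDecomposition S T₀ (etaleThetaDataOfSetting' C hC hS hchar S.toThetaSetting eS hl))
    (h16 : ThetaSetting.Thm16i ι)
    (γ ε : Pi C) (hγ : C.toLZ γ = Multiplicative.ofAdd 1) (hε₁ : (ε : D.PiTemp) ∈ D.GtpY)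
    (hε₂ : (ε : D.PiTemp) ∉ D.GtpYdd) (hZ : D.toZ (ι (γ : D.PiTemp)) = (D.toZ (γ : D.PiTemp))⁻¹)
    (δ : Pi C) (hιι : ∀ x : Pi C, ι (ι (x : D.PiTemp)) = (δ : D.PiTemp) * (x : D.PiTemp) * (δ : D.PiTemp)⁻¹)
    (hβ : ∀ a : D.GtpTheta, a ∈ D.DeltaTheta → c.thetaIso a * a⁻¹ ∈ D.lDeltaTheta l)
    (hιηY : ∃ τ : Pi C, (τ : D.PiTemp) ∈ D.GtpY ∧
      ThetaSetting.transport c h16 E.etaDd = ContH1.conj D.toTheta D.DeltaTheta (τ : D.PiTemp) E.etaDd)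
    (hO : D.IsEtThOrigin) (h15 : ThetaSetting.Prop15iii E hC) (h15ii : ThetaSetting.Prop15ii E.toKummerData hC) :
    Prop22_ii' Dec := by
  refine prop22_ii'_model_of_inversion_of_prop15_of_origin_orbit C ι hι c hC hS hchar S eS hl Dec γ ε hγ hε₁ hε₂
    hZ δ hιι hβ ?_ hO h15 h15ii
  obtain ⟨τ, hτY, hτ⟩ := hιηY
  refine ⟨τ, hτY, ?_⟩
  rw [autMap_comap_eq_comap_transport C ι hι c h16 (mem_PiYdd_iff_of_piYddCharacteristic C hchar _), hτ]
  exact ContH1.comap_conj D.toTheta D.DeltaTheta C.Huu.subtype continuous_subtype_val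
    (map_subtype_piYdd_inf_le_GtpYdd C ⊤) τ E.etaDd

end EtaleThetaDataOfSetting

end Literature.IUT.HodgeArakelov

/-! ## §2. AT THE [EtTh] MODEL OF RECORD -/

namespace Literature.AnabelianGeometry.EtaleTheta.SettingModel

open Literature.IUT.HodgeArakelov Literature.IUT.HodgeArakelov.EtaleThetaDataOfSetting
open Literature.AnabelianGeometry.SemiGraphs

variable (p : ℕ) [Fact p.Prime] (i j : ℤ) (hj : Even j)

/-- **abc-iut-w4-d010's fixed-lift binder `h14fix` HOLDS at the stage-2 model**: for every
étale-theta datum `E` over `modelχq p i j` carrying the class of record `η̈♯ = etaDdχq`, every `X̲̲`-choice `C` stable under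
the cocycle-corrected inversion `ι := inversionχq` (abc-iut-w5-d249), and EVERY theta companion `ι^Θ`, the pair
`(ι|Π^tp_X̲̲, ι^Θ)` FIXES the pull-back of `η̈^Θ` to `Π_Ÿ(Π)` — abc-iut-L2-d1's `transport_etaDdχq` (`ι_* η̈♯ = η̈♯`) through
`autMap_comap_eq_comap_transport`. [cite: MochizukiEtTh2009, Thm 1.6 (iii) p.24] -/
theorem autMap_comap_etaDd_eq_self_modelχq (E : (ThetaSetting.modelχq p i j hj).EtaleThetaData)
    (hE : E.etaDd = etaDdχq p i j hj) {l : ℕ} (C : E.DoubleUnderline l)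
    (hι : C.Huu.map (inversionχq p i j).toMulEquiv.toMonoidHom = C.Huu)
    (cι : ThetaSetting.ThetaCompanion (Dα := ThetaSetting.modelχq p i j hj) (Dβ := ThetaSetting.modelχq p i j hj)
      (inversionχq p i j))
    (hH : ∀ x, x ∈ PiYdd C ↔ inversionAlpha C (inversionχq p i j) hι x ∈ PiYdd C) :
    ContH1Aut.autMap (phi C) (ThetaSetting.modelχq p i j hj).DeltaTheta (inversionAlpha C (inversionχq p i j) hι)
        cι.thetaIso (thetaCompanion_phi C (inversionχq p i j) hι cι)
        (thetaCompanion_mem_deltaTheta (D := ThetaSetting.modelχq p i j hj) (inversionχq p i j) cι)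
        (symm_mem_inf_top (PiYdd C) (inversionAlpha C (inversionχq p i j) hι) hH)
        (ContH1.comap (ThetaSetting.modelχq p i j hj).toTheta (ThetaSetting.modelχq p i j hj).DeltaTheta C.Huu.subtype
          continuous_subtype_val (map_subtype_piYdd_inf_le_GtpYdd C ⊤) E.etaDd) =
      ContH1.comap (ThetaSetting.modelχq p i j hj).toTheta (ThetaSetting.modelχq p i j hj).DeltaTheta C.Huu.subtype
        continuous_subtype_val (map_subtype_piYdd_inf_le_GtpYdd C ⊤) E.etaDd := by
  rw [autMap_comap_eq_comap_transport C (inversionχq p i j) hι cι (isInversionAut_inversionχq p i j hj).thm16i hH, hE,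
    transport_etaDdχq p i j hj cι]

/-- **DIAGNOSTIC (abc-iut-w4-d010 g11's constraint (a) «the ι-representative is load-bearing», kernel-exact at the
stage-2 model)**: for `ι := inversionχq` and ANY theta companion, the UNWEAKENED binder `h14iota` of p430763 — «the pair
carries the pull-back of `η̈^Θ` to its `ε`-conjugate», `ε` a deck element — holds at the model IF AND ONLY IF the deck
element `ε` fixes the pull-back of `η̈♯` to `Π_Ÿ(Π)` (because the pair itself fixes it). So at the cocycle-corrected
representative the `τ₀ := ε` form is a statement about the DECK action alone, whereas the `τ₀ := 1` form holds outright;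
no side is taken on which representative print's `ι` is. [cite: MochizukiEtTh2009, Prop 1.4 (ii) p.22] -/
theorem h14iota_iff_deck_fixes_modelχq (E : (ThetaSetting.modelχq p i j hj).EtaleThetaData)
    (hE : E.etaDd = etaDdχq p i j hj) {l : ℕ} (C : E.DoubleUnderline l)
    (hι : C.Huu.map (inversionχq p i j).toMulEquiv.toMonoidHom = C.Huu)
    (cι : ThetaSetting.ThetaCompanion (Dα := ThetaSetting.modelχq p i j hj) (Dβ := ThetaSetting.modelχq p i j hj)
      (inversionχq p i j))
    (hH : ∀ x, x ∈ PiYdd C ↔ inversionAlpha C (inversionχq p i j) hι x ∈ PiYdd C) [(PiYdd C).Normal] (ε : Pi C) :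
    ContH1Aut.autMap (phi C) (ThetaSetting.modelχq p i j hj).DeltaTheta (inversionAlpha C (inversionχq p i j) hι)
        cι.thetaIso (thetaCompanion_phi C (inversionχq p i j) hι cι)
        (thetaCompanion_mem_deltaTheta (D := ThetaSetting.modelχq p i j hj) (inversionχq p i j) cι)
        (symm_mem_inf_top (PiYdd C) (inversionAlpha C (inversionχq p i j) hι) hH)
        (ContH1.comap (ThetaSetting.modelχq p i j hj).toTheta (ThetaSetting.modelχq p i j hj).DeltaTheta C.Huu.subtype
          continuous_subtype_val (map_subtype_piYdd_inf_le_GtpYdd C ⊤) E.etaDd) =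
      ContH1.conj (phi C) (ThetaSetting.modelχq p i j hj).DeltaTheta ε
        (ContH1.comap (ThetaSetting.modelχq p i j hj).toTheta (ThetaSetting.modelχq p i j hj).DeltaTheta C.Huu.subtype
          continuous_subtype_val (map_subtype_piYdd_inf_le_GtpYdd C ⊤) E.etaDd) ↔
    ContH1.comap (ThetaSetting.modelχq p i j hj).toTheta (ThetaSetting.modelχq p i j hj).DeltaTheta C.Huu.subtype
          continuous_subtype_val (map_subtype_piYdd_inf_le_GtpYdd C ⊤) E.etaDd =
      ContH1.conj (phi C) (ThetaSetting.modelχq p i j hj).DeltaTheta ε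
        (ContH1.comap (ThetaSetting.modelχq p i j hj).toTheta (ThetaSetting.modelχq p i j hj).DeltaTheta C.Huu.subtype
          continuous_subtype_val (map_subtype_piYdd_inf_le_GtpYdd C ⊤) E.etaDd) := by
  rw [autMap_comap_etaDd_eq_self_modelχq p i j hj E hE C hι cι hH]

/-- **IUTchII:Prop2.2(ii)′ — the μ_{2l}-clause closer AT THE STAGE-2 MODEL `modelχq p i j`**, for every étale-theta datum
`E` carrying `η̈♯ = etaDdχq` and every `ι`-stable `X̲̲`-choice `C`: the (R1) ι-DATUM IS A THEOREM here — `ι := inversionχq`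
(abc-iut-w5-d249) with `ι(Π^tp_X̲̲) = Π^tp_X̲̲` (`hι`, the only `C`-dependent clause), theta companion
`thetaCompanionOfAut` (abc-iut-w5-d072; `ι(Δ^tp_X) = Δ^tp_X`, `toTheta` a quotient map — abc-iut-L2-d1 / L2-t5),
`ℤ`-reversal (`IsInversionAut.toZ_apply`, abc-iut-L2-d1), `ι² = id` (`inversionχq_inversionχq`, `δ := 1`), `ι^Θ = +1` on
`Δ_Θ` (`thetaIso_inversionχq_apply_eq_self`), a deck element `ε` (`exists_deck_element`), a `toLZ`-generator `γ`
(`toLZ_surjective`); abc-iut-w4-d010's FIXED-LIFT binder `h14fix` of `prop22_ii'_model_of_inversion_of_prop15_of_origin_fixed`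
(p457679) HOLDS (`autMap_comap_etaDd_eq_self_modelχq`, i.e. abc-iut-L2-d1's `transport_etaDdχq`); the guard
`IsEtThOrigin` (F-2498) is abc-iut-L2-t5's `modelχq_isEtThOrigin`, `hC`/`hS` are `compat_modelχq` / `modelχq_sec2Hyps`.
RESIDUAL: [EtTh] Prop. 1.5 (iii)/(ii) for `E` (`h15`, `h15ii` — theorems at the Tate instance below), (H1)
`PiYddCharacteristic C` (F-2633 at the instance) and the [IUTchII]-side DATA `S, eS, hl, T₀, Dec`.
SEMI-SYNTHETIC MODEL: binder-discharge / joint-satisfiability evidence only. [claim: Mochizuki2012, status: disputed]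
(IUTchII §2 Prop 2.2 (ii), kurims p.66) -/
theorem prop22_ii'_modelχq_of_etaDd_eq (E : (ThetaSetting.modelχq p i j hj).EtaleThetaData)
    (hE : E.etaDd = etaDdχq p i j hj) {l : ℕ} (C : E.DoubleUnderline l)
    (hι : C.Huu.map (inversionχq p i j).toMulEquiv.toMonoidHom = C.Huu) (hchar : PiYddCharacteristic C)
    (S : BadPlaceSetting.{0}) (eS : (Pi C) ≃ₜ* S.PiX) (hl : S.l = l) {T₀ : TemperedCoverings S (Pi C)}
    (Dec : SubgraphDecomposition S T₀ (etaleThetaDataOfSetting' C (compat_modelχq p i j hj)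
      (ThetaSetting.modelχq_sec2Hyps p i j hj) hchar S.toThetaSetting eS hl))
    (h15 : ThetaSetting.Prop15iii E (compat_modelχq p i j hj))
    (h15ii : ThetaSetting.Prop15ii E.toKummerData (compat_modelχq p i j hj)) :
    Prop22_ii' Dec := by
  haveI := piYdd_normal C (compat_modelχq p i j hj)
  haveI := (compat_modelχq p i j hj).GtpYdd_normal
  obtain ⟨γ, hγ⟩ := C.toLZ_surjective (Multiplicative.ofAdd 1)
  obtain ⟨ε, hε₁, hε₂⟩ := exists_deck_element C (ThetaSetting.modelχq_sec2Hyps p i j hj)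
  let cι : ThetaSetting.ThetaCompanion (Dα := ThetaSetting.modelχq p i j hj) (Dβ := ThetaSetting.modelχq p i j hj)
      (inversionχq p i j) :=
    (ThetaSetting.modelχq p i j hj).thetaCompanionOfAut (inversionχq p i j)
      (isInversionAut_inversionχq p i j hj).map_deltaTemp (hasThetaTopology_modelχq p i j hj).isQuotientMap_toTheta
  exact prop22_ii'_model_of_inversion_of_prop15_of_origin_fixed C (inversionχq p i j) hι cι (compat_modelχq p i j hj)
    (ThetaSetting.modelχq_sec2Hyps p i j hj) hchar S eS hl Dec γ ε hγ hε₁ hε₂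
    ((isInversionAut_inversionχq p i j hj).toZ_apply _) 1
    (fun x => by
      rw [OneMemClass.coe_one, one_mul, inv_one, mul_one]
      exact inversionχq_inversionχq p i j _)
    (fun a ha => by
      rw [thetaIso_inversionχq_apply_eq_self p i j hj cι ha, mul_inv_cancel]
      exact Subgroup.one_mem _)
    (autMap_comap_etaDd_eq_self_modelχq p i j hj E hE C hι cι
      (mem_PiYdd_iff_of_piYddCharacteristic C hchar _)) (ThetaSetting.modelχq_isEtThOrigin p i j hj) h15 h15ii


/-! ### The Tate instance `modelTate p = modelχq p 1 2`: [EtTh] Prop. 1.5 (iii), (ii) DISCHARGED at the section data -/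

section TateSection

variable (s : GQp p →* (ThetaSetting.modelTate p).PiTemp) (hs : Continuous s)
  (hsec : ∀ σ : GQp p, (ThetaSetting.modelTate p).aug (s σ) = σ)
  (hsY : (ThetaSetting.modelTate p).GK.map s ≤ (ThetaSetting.modelTate p).GtpY)
  (hsYdd : (ThetaSetting.modelTate p).GKdd.map s ≤ (ThetaSetting.modelTate p).GtpYdd)

/-- **IUTchII:Prop2.2(ii)′ — the μ_{2l}-clause closer AT THE TATE INSTANCE, section datum `E_s` of ANY continuous Galois
section `s`** (class of record `η̈♯ = etaDdχq`): on top of `prop22_ii'_modelχq_of_etaDd_eq`, the §1 named facts [EtTh]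
Prop. 1.5 (iii) (F-0591; abc-iut-L2-t6's `prop15iii_etaleThetaDataOfClass_etaDdχq`) and Prop. 1.5 (ii) (F-2503; abc-iut-L2-t8's
`prop13_prop15_sectionData_modelTate`) are THEOREMS. RESIDUAL for every `ι`-stable `X̲̲`-choice `C` over `E_s`: (H1)
`PiYddCharacteristic C` (F-2633 at the instance) and the [IUTchII]-side DATA `S, eS, hl, T₀, Dec` — NO ι-datum binder, NO
class-level binder, NO §1 fact binder. [claim: Mochizuki2012, status: disputed] (IUTchII §2 Prop 2.2 (ii), kurims p.66) -/
theorem prop22_ii'_modelTate_ofSection {l : ℕ}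
    (C : (((kummerCoreχq p 1 2 even_two).toKummerDataOfSection s hs hsec hsY hsYdd).etaleThetaDataOfClass
      (etaDdχq p 1 2 even_two)).DoubleUnderline l)
    (hι : C.Huu.map (inversionχq p 1 2).toMulEquiv.toMonoidHom = C.Huu) (hchar : PiYddCharacteristic C)
    (S : BadPlaceSetting.{0}) (eS : (Pi C) ≃ₜ* S.PiX) (hl : S.l = l) {T₀ : TemperedCoverings S (Pi C)}
    (Dec : SubgraphDecomposition S T₀ (etaleThetaDataOfSetting' C (compat_modelχq p 1 2 even_two)
      (ThetaSetting.modelχq_sec2Hyps p 1 2 even_two) hchar S.toThetaSetting eS hl)) :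
    Prop22_ii' Dec :=
  prop22_ii'_modelχq_of_etaDd_eq p 1 2 even_two _ rfl C hι hchar S eS hl Dec
    (prop15iii_etaleThetaDataOfClass_etaDdχq p (compat_modelχq p 1 2 even_two) s hs hsec hsY hsYdd)
    (prop13_prop15_sectionData_modelTate p s hs hsec hsY hsYdd (compat_modelχq p 1 2 even_two)).2.2.1

end TateSection

/-! ### CLOSED at the Galois factor `inr` and the `X̲̲` of record: residual = (H1) + the [IUTchII]-side data -/

/-- **IUTchII:Prop2.2(ii)′ — the μ_{2l}-clause closer AT THE [EtTh] MODEL OF RECORD** (`modelTate p`, Galois factor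
`inr`, class `η̈♯ = etaDdχq`, `X̲̲ := Huuχq` via abc-iut-L2-d1/L2-t8's `doubleUnderlineχqOfEtaRes`): here ALSO the
`ι`-stability of `Π^tp_X̲̲` is a theorem (abc-iut-L2-d1's `map_Huuχq_inversionχq`), so for every odd `l` the ONLY residual
binders of the landed L6 closer of IUTchII:Prop2.2(ii) (abc-iut-w4-d010 p430763 / abc-iut-L2-t8 / abc-iut-w5-d072) are
(H1) `PiYddCharacteristic C` ([IUTchII] Prop. 1.4 clause «`Π_Ÿ(Π)` corresponding to `Ÿ`», [EtTh] Cor. 2.18 (i)-class;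
FACT-LIST F-2633 AT THIS INSTANCE) and the [IUTchII]-side DATA (`S`, `eS`, `hl`, `T₀`, and the Prop. 2.2 (i) datum `Dec`).
SEMI-SYNTHETIC MODEL: binder-discharge / joint-satisfiability evidence for the typed interface at the cell's model of
record, not the tempered `π₁` of a curve; nothing of [EtTh]/[IUTchII] asserted; no side taken on [IUTchIII] Cor. 3.12.
[claim: Mochizuki2012, status: disputed] (IUTchII §2 Prop 2.2 (ii), kurims p.66) -/
theorem prop22_ii'_modelTate (l : ℕ+) (hlo : Odd (l : ℕ))
    (hchar : PiYddCharacteristic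
      ((((kummerCoreχq p 1 2 even_two).toKummerDataOfSection SemidirectProduct.inr (continuous_inrχq p 1 2)
        (fun _ => rfl) (map_inr_GK_le_GtpY_modelχq' p 1 2 even_two)
        (map_inr_GKdd_le_GtpYdd_modelχq' p 1 2 even_two)).etaleThetaDataOfClass
        (etaDdχq p 1 2 even_two)).doubleUnderlineχqOfEtaRes p 1 2 l hlo (eta_res_etaDdχq p 1 2 even_two l hlo)))
    (S : BadPlaceSetting.{0})
    (eS : (Pi ((((kummerCoreχq p 1 2 even_two).toKummerDataOfSection SemidirectProduct.inr (continuous_inrχq p 1 2)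
        (fun _ => rfl) (map_inr_GK_le_GtpY_modelχq' p 1 2 even_two)
        (map_inr_GKdd_le_GtpYdd_modelχq' p 1 2 even_two)).etaleThetaDataOfClass
        (etaDdχq p 1 2 even_two)).doubleUnderlineχqOfEtaRes p 1 2 l hlo (eta_res_etaDdχq p 1 2 even_two l hlo))) ≃ₜ*
      S.PiX)
    (hl : S.l = l)
    {T₀ : TemperedCoverings S (Pi ((((kummerCoreχq p 1 2 even_two).toKummerDataOfSection SemidirectProduct.inr
        (continuous_inrχq p 1 2) (fun _ => rfl) (map_inr_GK_le_GtpY_modelχq' p 1 2 even_two)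
        (map_inr_GKdd_le_GtpYdd_modelχq' p 1 2 even_two)).etaleThetaDataOfClass
        (etaDdχq p 1 2 even_two)).doubleUnderlineχqOfEtaRes p 1 2 l hlo (eta_res_etaDdχq p 1 2 even_two l hlo)))}
    (Dec : SubgraphDecomposition S T₀ (etaleThetaDataOfSetting'
      ((((kummerCoreχq p 1 2 even_two).toKummerDataOfSection SemidirectProduct.inr (continuous_inrχq p 1 2)
        (fun _ => rfl) (map_inr_GK_le_GtpY_modelχq' p 1 2 even_two)
        (map_inr_GKdd_le_GtpYdd_modelχq' p 1 2 even_two)).etaleThetaDataOfClass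
        (etaDdχq p 1 2 even_two)).doubleUnderlineχqOfEtaRes p 1 2 l hlo (eta_res_etaDdχq p 1 2 even_two l hlo))
      (compat_modelχq p 1 2 even_two) (ThetaSetting.modelχq_sec2Hyps p 1 2 even_two) hchar S.toThetaSetting eS hl)) :
    Prop22_ii' Dec :=
  prop22_ii'_modelTate_ofSection p SemidirectProduct.inr (continuous_inrχq p 1 2) (fun _ => rfl)
    (map_inr_GK_le_GtpY_modelχq' p 1 2 even_two) (map_inr_GKdd_le_GtpYdd_modelχq' p 1 2 even_two) _
    (map_Huuχq_inversionχq p 1 2 l hlo) hchar S eS hl Dec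

/-! ### APPENDIX (gen 4, append-only): (H1) traded for [EtTh] Cor. 2.18 (i) at the instance — ROUTE A of record -/

/-- **IUTchII:Prop2.2(ii)′ AT THE MODEL OF RECORD with (H1) DISCHARGED MODULO [EtTh] Cor. 2.18 (i) at the instance**
(abc-iut-L6-lead's ROUTE A of record for the sibling row IUTchII:Prop2.1, §F v1.19at: ⟨F-0620, F-0591 at the instance⟩
— here F-0591 is already a theorem): `prop22_ii'_modelTate` with `hchar := piYddCharacteristic_of_cor218_i …`
(abc-iut-w4-d013), for ANY cyclotome `μ` of level `N` and the EMPTY cusp labelling of record. RESIDUAL for the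
μ_{2l}-clause of IUTchII:Prop2.2(ii) at `(modelTate p, inr, X̲̲ of record)` on this route: {FACT-LIST F-0620
`RigidData.Cor218_i` AT THE INSTANCE `C.rigidData μ …` (abc-iut-L6-d6's row «COR218I-AT-MODELTATE» decides it), the
[IUTchII]-side DATA}. SEMI-SYNTHETIC MODEL, binder-discharge evidence only; no side taken on [IUTchIII] Cor. 3.12.
[claim: Mochizuki2012, status: disputed] (IUTchII §2 Prop 2.2 (ii), kurims p.66) -/
theorem prop22_ii'_modelTate_of_cor218_i (l : ℕ+) (hlo : Odd (l : ℕ)) {N : ℕ+}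
    (μ : (ThetaSetting.modelTate p).CyclotomeMod l N)
    (h218i : (((((kummerCoreχq p 1 2 even_two).toKummerDataOfSection SemidirectProduct.inr (continuous_inrχq p 1 2)
        (fun _ => rfl) (map_inr_GK_le_GtpY_modelχq' p 1 2 even_two)
        (map_inr_GKdd_le_GtpYdd_modelχq' p 1 2 even_two)).etaleThetaDataOfClass
        (etaDdχq p 1 2 even_two)).doubleUnderlineχqOfEtaRes p 1 2 l hlo (eta_res_etaDdχq p 1 2 even_two l hlo)).rigidData
        μ (compat_modelχq p 1 2 even_two) (ThetaSetting.modelχq_sec2Hyps p 1 2 even_two)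
        (prop15iii_etaleThetaDataOfClass_etaDdχq p (compat_modelχq p 1 2 even_two) SemidirectProduct.inr
          (continuous_inrχq p 1 2) (fun _ => rfl) (map_inr_GK_le_GtpY_modelχq' p 1 2 even_two)
          (map_inr_GKdd_le_GtpYdd_modelχq' p 1 2 even_two))
        ⟨fun _ => ∅, fun _ => ∅, fun _ => rfl⟩).Cor218_i)
    (S : BadPlaceSetting.{0})
    (eS : (Pi ((((kummerCoreχq p 1 2 even_two).toKummerDataOfSection SemidirectProduct.inr (continuous_inrχq p 1 2)
        (fun _ => rfl) (map_inr_GK_le_GtpY_modelχq' p 1 2 even_two)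
        (map_inr_GKdd_le_GtpYdd_modelχq' p 1 2 even_two)).etaleThetaDataOfClass
        (etaDdχq p 1 2 even_two)).doubleUnderlineχqOfEtaRes p 1 2 l hlo (eta_res_etaDdχq p 1 2 even_two l hlo))) ≃ₜ*
      S.PiX)
    (hl : S.l = l)
    {T₀ : TemperedCoverings S (Pi ((((kummerCoreχq p 1 2 even_two).toKummerDataOfSection SemidirectProduct.inr
        (continuous_inrχq p 1 2) (fun _ => rfl) (map_inr_GK_le_GtpY_modelχq' p 1 2 even_two)
        (map_inr_GKdd_le_GtpYdd_modelχq' p 1 2 even_two)).etaleThetaDataOfClass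
        (etaDdχq p 1 2 even_two)).doubleUnderlineχqOfEtaRes p 1 2 l hlo (eta_res_etaDdχq p 1 2 even_two l hlo)))}
    (Dec : SubgraphDecomposition S T₀ (etaleThetaDataOfSetting'
      ((((kummerCoreχq p 1 2 even_two).toKummerDataOfSection SemidirectProduct.inr (continuous_inrχq p 1 2)
        (fun _ => rfl) (map_inr_GK_le_GtpY_modelχq' p 1 2 even_two)
        (map_inr_GKdd_le_GtpYdd_modelχq' p 1 2 even_two)).etaleThetaDataOfClass
        (etaDdχq p 1 2 even_two)).doubleUnderlineχqOfEtaRes p 1 2 l hlo (eta_res_etaDdχq p 1 2 even_two l hlo))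
      (compat_modelχq p 1 2 even_two) (ThetaSetting.modelχq_sec2Hyps p 1 2 even_two)
      (piYddCharacteristic_of_cor218_i _ μ (compat_modelχq p 1 2 even_two) (ThetaSetting.modelχq_sec2Hyps p 1 2 even_two)
        (prop15iii_etaleThetaDataOfClass_etaDdχq p (compat_modelχq p 1 2 even_two) SemidirectProduct.inr
          (continuous_inrχq p 1 2) (fun _ => rfl) (map_inr_GK_le_GtpY_modelχq' p 1 2 even_two)
          (map_inr_GKdd_le_GtpYdd_modelχq' p 1 2 even_two))
        ⟨fun _ => ∅, fun _ => ∅, fun _ => rfl⟩ _ rfl h218i)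
      S.toThetaSetting eS hl)) :
    Prop22_ii' Dec :=
  prop22_ii'_modelTate p l hlo _ S eS hl Dec

end Literature.AnabelianGeometry.EtaleTheta.SettingModel

end
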